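import Literature.AlgebraicGeometry.Resolution.WeightedBlowupNoIncrease
import Literature.AlgebraicGeometry.Resolution.WeightedBlowupMonomialValuation
import Mathlib.RingTheory.MvPolynomial.WeightedHomogeneous
import HarnessLib

/-!
# The order after a weighted step is bounded by the order of the initial form on the exceptional divisor
(`pub-rosobs`, carver-g38; companion of `WeightedBlowupNoIncrease` / `WeightedCentreStep`)

Polynomial model of ONE weighted blow-up step, conventions of `WeightedBlowupShade`: residual `F ∈ K[u_σ]`,
integer weights `w`, level `ℓ`, cobordant (proper) transform `F' = s^{-ℓ} F(s^{w} u')` with the exceptional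
variable `s = none` [cite: AbramovichQuekSchober2025, Def. 4.5 (proper transform on B)], and the transform
seen at a point `b` of the exceptional divisor `{s = 0}` (`b none = 0`), `pointPolynomial w ℓ b F = F'(s, u' + b)`.

Main statement (derived here, elementary): if the centre is admissible for `F` in integer form
(`ℓ ≤ Σ wᵢdᵢ` on the support), then
`ord (pointPolynomial w ℓ b F) ≤ ord_{b} (in_w F)`,
where `in_w F := weightedHomogeneousComponent w ℓ F` is the `w`-INITIAL FORM of `F` (the monomials of weight
exactly `ℓ`, i.e. on the face `v_J = 1`) and `ord_b` is the order after the translation `u ↦ u + b|_σ`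
(`monomialOrd_one_pointPolynomial_le_initialForm`; for any weights `w'` on `u'` in place of the order,
`monomialOrd_pointPolynomial_le_initialForm`).  Mechanism: restriction to the exceptional divisor `s = 0`
does not lower the order of a polynomial (`monomialOrd_le_excRestrict`), it commutes with the translation
(`excRestrict_translate`), and the restriction of `F'` to `s = 0` IS the initial form `in_w F` in the variables `u'`
(`excRestrict_cobordantTransform`) — the fibre `s = 0` of the degeneration `B → 𝔸¹` is the weighted normal cone
[cite: AbramovichQuekSchober2025, Construction 4.2 (the fibre s = 0 is the weighted normal cone)].
Consequence for the step census: a point `b` over the origin at which the order does NOT drop (`ord = ν = ord F`)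
lies on the `ν`-fold locus of the initial form `in_w F` on the weighted normal cone; off that locus the first
entry of the invariant drops.  This is the mechanism of [cite: AbramovichQuekSchober2024, Thm. 1.1 (3) and §6
("The order drops": for plane curves `f_{J,1}` is not a `ν`-th power, so the order drops at every point)],
here as an inequality valid in every dimension and characteristic, for every centre admissible in integer form.
NOT a resolution theorem; instrument typing, NOT summit progress.
-/

open MvPolynomial Finset

open scoped BigOperators

namespace Literature.AlgebraicGeometry.Resolution

namespace WeightedBlowup

noncomputable section

variable {σ : Type*} {K : Type*} [CommRing K]

/-! ## Restriction to the exceptional divisor `s = 0` -/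

/-- Restriction to the exceptional divisor `{s = 0}` of the cobordant chart: `s ↦ 0`, `u'_i ↦ u'_i`
(as a `K`-algebra endomorphism of `K[s, u']`). [cite: AbramovichQuekSchober2025, Construction 4.2 (the fibre s = 0)] -/
def excRestrict : MvPolynomial (Option σ) K →ₐ[K] MvPolynomial (Option σ) K :=
  aeval fun o => Option.elim o 0 fun i => X (some i)

/-- `s ↦ 0`. [cite: AbramovichQuekSchober2025, Construction 4.2] -/
@[simp] theorem excRestrict_X_none : excRestrict (X none : MvPolynomial (Option σ) K) = 0 := by
  simp [excRestrict]

/-- `u'_i ↦ u'_i`. [cite: AbramovichQuekSchober2025, Construction 4.2] -/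
@[simp] theorem excRestrict_X_some (i : σ) :
    excRestrict (X (some i) : MvPolynomial (Option σ) K) = X (some i) := by
  simp [excRestrict]

/-- constants are fixed. [cite: AbramovichQuekSchober2025, Construction 4.2] -/
@[simp] theorem excRestrict_C (c : K) : excRestrict (C c : MvPolynomial (Option σ) K) = C c :=
  AlgHom.commutes _ c

/-- On a monomial: kept if `s` does not occur, killed otherwise. (derived here)
[cite: AbramovichQuekSchober2025, Construction 4.2 (the fibre s = 0)] -/
theorem excRestrict_monomial [DecidableEq σ] (E : Option σ →₀ ℕ) (c : K) :
    excRestrict (monomial E c : MvPolynomial (Option σ) K) = if E none = 0 then monomial E c else 0 := by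
  classical
  unfold excRestrict
  rw [aeval_monomial, algebraMap_eq]
  split_ifs with h
  · rw [monomial_eq]
    congr 1
    apply Finsupp.prod_congr
    intro o ho
    have hne : o ≠ none := by
      rintro rfl
      exact (Finsupp.mem_support_iff.mp ho) h
    obtain ⟨i, rfl⟩ := Option.ne_none_iff_exists'.mp hne
    rfl
  · have hmem : none ∈ E.support := Finsupp.mem_support_iff.mpr h
    rw [Finsupp.prod, Finset.prod_eq_zero hmem (by simp [h]), mul_zero]

/-- Coefficients of the restriction: those of the monomials without `s`. (derived here)
[cite: AbramovichQuekSchober2025, Construction 4.2 (the fibre s = 0)] -/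
theorem coeff_excRestrict [DecidableEq σ] (G : MvPolynomial (Option σ) K) (D : Option σ →₀ ℕ) :
    coeff D (excRestrict G) = if D none = 0 then coeff D G else 0 := by
  classical
  conv_lhs => rw [G.as_sum, map_sum]
  simp_rw [excRestrict_monomial]
  rw [coeff_sum]
  split_ifs with hD
  · rw [Finset.sum_eq_single D]
    · simp [hD]
    · intro E _ hED
      split_ifs
      · rw [coeff_monomial, if_neg hED]
      · simp
    · intro hDs
      simp [hD, notMem_support_iff.mp hDs]
  · apply Finset.sum_eq_zero
    intro E _
    split_ifs with hE
    · rw [coeff_monomial, if_neg]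
      rintro rfl
      exact hD hE
    · simp

/-- The support of the restriction is contained in the support. (derived here)
[cite: AbramovichQuekSchober2025, Construction 4.2] -/
theorem support_excRestrict_subset [DecidableEq σ] (G : MvPolynomial (Option σ) K) :
    (excRestrict G).support ⊆ G.support := by
  intro D hD
  rw [mem_support_iff, coeff_excRestrict] at hD
  split_ifs at hD with h
  · exact mem_support_iff.mpr hD
  · exact absurd rfl hD

/-- **Restriction to `s = 0` does not lower the order** (for any weights on `(s, u')`):
`ord G ≤ ord (G|_{s=0})` (`⊤` on the right if the restriction vanishes). (derived here)
[cite: AbramovichQuekSchober2024, §6 (proof of "The order drops": ν ≤ ν^{log})] -/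
theorem monomialOrd_le_excRestrict [DecidableEq σ] (w' : Option σ → ℕ) (G : MvPolynomial (Option σ) K) :
    monomialOrd w' G ≤ monomialOrd w' (excRestrict G) := by
  classical
  by_cases h0 : excRestrict G = 0
  · rw [h0, monomialOrd_zero]
    exact le_top
  obtain ⟨D, hD, hDw⟩ := exists_weight_eq_monomialOrd w' h0
  rw [← hDw]
  exact monomialOrd_le_weight w' (support_excRestrict_subset G hD)

/-- Restriction to `s = 0` commutes with the translation by a point OF the divisor (`b none = 0`).
(derived here) [cite: AbramovichQuekSchober2025, Construction 4.2] -/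
theorem excRestrict_translate (b : Option σ → K) (hb0 : b none = 0) (G : MvPolynomial (Option σ) K) :
    excRestrict (PointBlowup.translate b G) = PointBlowup.translate b (excRestrict G) := by
  have h : (excRestrict.comp (aeval fun i => (X i + C (b i) : MvPolynomial (Option σ) K))) =
      (aeval fun i => (X i + C (b i) : MvPolynomial (Option σ) K)).comp excRestrict := by
    apply MvPolynomial.algHom_ext
    intro o
    cases o with
    | none => simp [hb0]
    | some i => simp
  exact congrArg (fun φ : MvPolynomial (Option σ) K →ₐ[K] MvPolynomial (Option σ) K => φ G) h

/-- Translation commutes with the inclusion `u ↦ u'` of the old variables: translating `G(u')` by `b` is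
translating `G(u)` by `b|_σ`. (derived here) [cite: AbramovichQuekSchober2025, Def. 4.5] -/
theorem translate_rename_some (b : Option σ → K) (H : MvPolynomial σ K) :
    PointBlowup.translate b (rename some H) = rename some (PointBlowup.translate (fun i => b (some i)) H) := by
  unfold PointBlowup.translate
  rw [aeval_rename, ← AlgHom.comp_apply]
  congr 1
  apply MvPolynomial.algHom_ext
  intro i
  simp [Function.comp]

section Cone

variable [Fintype σ] [DecidableEq σ]

/-- **The restriction of the proper transform to the exceptional divisor is the initial form**:
`F'|_{s=0} = in_w F (u')`, `in_w F := weightedHomogeneousComponent w ℓ F` (the monomials on the face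
`Σ wᵢdᵢ = ℓ`), for a centre admissible in integer form (`ℓ ≤ Σ wᵢdᵢ` on the support). (derived here)
[cite: AbramovichQuekSchober2025, Construction 4.2 (the fibre s = 0 of B is the weighted normal cone)] -/
theorem excRestrict_cobordantTransform (w : σ → ℕ) (ℓ : ℕ) (F : MvPolynomial σ K)
    (hF : ∀ d ∈ F.support, ℓ ≤ Finsupp.weight w d) :
    excRestrict (cobordantTransform w ℓ F) = rename some (weightedHomogeneousComponent w ℓ F) := by
  classical
  rw [cobordantTransform, map_sum, weightedHomogeneousComponent_apply, map_sum, Finset.sum_filter]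
  apply Finset.sum_congr rfl
  intro d hd
  rw [excRestrict_monomial, rename_monomial]
  have hnone : cobordantExponent w ℓ d none = (∑ i, w i * d i) - ℓ := cobordantExponent_none w ℓ d
  have hwt : Finsupp.weight w d = ∑ i, w i * d i := by
    rw [Finsupp.weight_apply, Finsupp.sum_fintype _ _ (fun i => by simp)]
    simp_rw [smul_eq_mul, mul_comm]
  by_cases hface : Finsupp.weight w d = ℓ
  · have h0 : cobordantExponent w ℓ d none = 0 := by rw [hnone, ← hwt, hface, Nat.sub_self]
    have hE : cobordantExponent w ℓ d = Finsupp.mapDomain some d := by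
      ext o
      cases o with
      | none => rw [h0, Finsupp.mapDomain_notin_range _ _ (by simp)]
      | some i => rw [cobordantExponent_some, Finsupp.mapDomain_apply (Option.some_injective σ)]
    rw [if_pos h0, if_pos hface, hE]
  · have hlt : ℓ < Finsupp.weight w d := lt_of_le_of_ne (hF d hd) (Ne.symm hface)
    have hne : cobordantExponent w ℓ d none ≠ 0 := by
      rw [hnone, ← hwt]
      exact Nat.sub_ne_zero_of_lt hlt
    rw [if_neg hne, if_neg hface]

/-- The transform at a point `b` of the divisor, restricted to the divisor, is the initial form translated by
`b|_σ`: `F'(s, u'+b)|_{s=0} = (in_w F)(u' + b)`. (derived here)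
[cite: AbramovichQuekSchober2025, Construction 4.2 and Def. 4.5] -/
theorem excRestrict_pointPolynomial (w : σ → ℕ) (ℓ : ℕ) (b : Option σ → K) (hb0 : b none = 0)
    (F : MvPolynomial σ K) (hF : ∀ d ∈ F.support, ℓ ≤ Finsupp.weight w d) :
    excRestrict (pointPolynomial w ℓ b F) =
      rename some (PointBlowup.translate (fun i => b (some i)) (weightedHomogeneousComponent w ℓ F)) := by
  rw [pointPolynomial, excRestrict_translate b hb0, excRestrict_cobordantTransform w ℓ F hF,
    translate_rename_some]

omit [Fintype σ] in
/-- `rename some` does not change the weighted order for weights `w'` on `(s,u')` restricted to `u'`.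
(derived here) [cite: AbramovichTemkinWlodarczyk2024, Rem. 2.4.2 (monomial valuation)] -/
theorem monomialOrd_rename_some (w' : Option σ → ℕ) (H : MvPolynomial σ K) :
    monomialOrd w' (rename some H) = monomialOrd (fun i => w' (some i)) H := by
  classical
  have hsupp : (rename some H).support = H.support.map (Finsupp.mapDomainEmbedding (Function.Embedding.some)) := by
    ext D
    rw [Finset.mem_map]
    constructor
    · intro hD
      obtain ⟨d, hd, rfl⟩ : ∃ d ∈ H.support, Finsupp.mapDomain some d = D := by
        have := support_rename_of_injective (Option.some_injective σ) (p := H)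
        rw [this, Finset.mem_image] at hD
        exact hD
      exact ⟨d, hd, rfl⟩
    · rintro ⟨d, hd, rfl⟩
      rw [support_rename_of_injective (Option.some_injective σ), Finset.mem_image]
      exact ⟨d, hd, rfl⟩
  have hwt : ∀ d : σ →₀ ℕ, Finsupp.weight w' (Finsupp.mapDomain some d) = Finsupp.weight (fun i => w' (some i)) d := by
    intro d
    simp only [Finsupp.weight_apply]
    rw [Finsupp.sum_mapDomain_index (fun _ => by simp) (fun _ _ _ => by simp [add_mul])]
  apply le_antisymm
  · by_cases hH : H = 0
    · simp [hH, monomialOrd_zero]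
    obtain ⟨d, hd, hdw⟩ := exists_weight_eq_monomialOrd (fun i => w' (some i)) hH
    rw [← hdw, ← hwt]
    apply monomialOrd_le_weight
    rw [hsupp, Finset.mem_map]
    exact ⟨d, hd, rfl⟩
  · by_cases hH : rename some H = 0
    · rw [hH, monomialOrd_zero]; exact le_top
    obtain ⟨D, hD, hDw⟩ := exists_weight_eq_monomialOrd w' hH
    rw [hsupp, Finset.mem_map] at hD
    obtain ⟨d, hd, rfl⟩ := hD
    rw [← hDw]
    change _ ≤ (Finsupp.weight w' (Finsupp.mapDomain some d) : ℕ∞)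
    rw [hwt]
    exact monomialOrd_le_weight _ hd

/-- **The order after the step is at most the order of the initial form at the point** (any weights `w'` on
`u'`, extended by any value on `s`): `ord_{w'} F'(s, u'+b) ≤ ord_{w'} (in_w F)(u'+b|_σ)` for every point `b` of
the exceptional divisor and every centre admissible in integer form. (derived here)
[cite: AbramovichQuekSchober2024, Thm. 1.1 (3) and §6 (order drops where f_{J,1} is not a ν-th power)],
[cite: AbramovichQuekSchober2025, Construction 4.2] -/
theorem monomialOrd_pointPolynomial_le_initialForm (w' : Option σ → ℕ) (w : σ → ℕ) (ℓ : ℕ)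
    (b : Option σ → K) (hb0 : b none = 0) (F : MvPolynomial σ K) (hF : ∀ d ∈ F.support, ℓ ≤ Finsupp.weight w d) :
    monomialOrd w' (pointPolynomial w ℓ b F) ≤
      monomialOrd (fun i => w' (some i))
        (PointBlowup.translate (fun i => b (some i)) (weightedHomogeneousComponent w ℓ F)) := by
  calc monomialOrd w' (pointPolynomial w ℓ b F)
      ≤ monomialOrd w' (excRestrict (pointPolynomial w ℓ b F)) := monomialOrd_le_excRestrict w' _
    _ = monomialOrd (fun i => w' (some i))
          (PointBlowup.translate (fun i => b (some i)) (weightedHomogeneousComponent w ℓ F)) := by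
        rw [excRestrict_pointPolynomial w ℓ b hb0 F hF, monomialOrd_rename_some]

/-- **ORDER form** (all weights `1`): `ord₀ F'(s, u'+b) ≤ ord_{b|_σ} (in_w F)`.  Hence a point over the origin
at which the order does not drop below `ν = ord F` lies on the `ν`-fold locus of the initial form `in_w F` on the
weighted normal cone `{s = 0}`. (derived here)
[cite: AbramovichQuekSchober2024, Thm. 1.1 (3) and §6], [cite: AbramovichTemkinWlodarczyk2024, Thm. 6.2.1 (p. 1581)
(there: char 0, the whole invariant drops)] -/
theorem monomialOrd_one_pointPolynomial_le_initialForm (w : σ → ℕ) (ℓ : ℕ) (b : Option σ → K)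
    (hb0 : b none = 0) (F : MvPolynomial σ K) (hF : ∀ d ∈ F.support, ℓ ≤ Finsupp.weight w d) :
    monomialOrd (fun _ => 1) (pointPolynomial w ℓ b F) ≤
      monomialOrd (fun _ => 1)
        (PointBlowup.translate (fun i => b (some i)) (weightedHomogeneousComponent w ℓ F)) :=
  monomialOrd_pointPolynomial_le_initialForm (fun _ => 1) w ℓ b hb0 F hF

/-- Contrapositive reading used by the census: if the initial form has order `< ν` at `b|_σ`, the order of
the transform at `b` is `< ν` — the first entry of the invariant DROPS there. (derived here)
[cite: AbramovichQuekSchober2024, Thm. 1.1 (3)] -/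
theorem monomialOrd_one_pointPolynomial_lt_of_initialForm_lt (w : σ → ℕ) (ℓ : ℕ) (b : Option σ → K)
    (hb0 : b none = 0) (F : MvPolynomial σ K) (hF : ∀ d ∈ F.support, ℓ ≤ Finsupp.weight w d) {ν : ℕ∞}
    (hlt : monomialOrd (fun _ => 1)
        (PointBlowup.translate (fun i => b (some i)) (weightedHomogeneousComponent w ℓ F)) < ν) :
    monomialOrd (fun _ => 1) (pointPolynomial w ℓ b F) < ν :=
  lt_of_le_of_lt (monomialOrd_one_pointPolynomial_le_initialForm w ℓ b hb0 F hF) hlt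

end Cone

end

end WeightedBlowup

end Literature.AlgebraicGeometry.Resolution
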